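import Summits.ResolutionOfSingularities.ResolutionOfSingularities.Theorems.PurelyInseparableDim4PhiLineSupercritical
import HarnessLib

/-!
# (K-Φ2) XV-bis: the KEEP law of the Φ-line for ANY boundary letter (cleaning exponent `0 < n < p`, no `n ≤ d`) — the one-step
# input that lets a SUBCRITICAL letter carry the β-potential once the letter-SET reading (K-Φ1)-T supplies its α-bound
# (cell `res-dim4-pi`, K2(p) lane, rung-1 p-generic Φ-side tool)

[OURS · counted 0 · cell `res-dim4-pi` · seat res-dim4-p-11 g5 (Φ-line lineage).]  Nothing here proves any TAIL(p, d, e), K2(p) or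
resolution of singularities in dimension ≥ 4 / characteristic `p` — NOT proved.  AI kernel work, weaker than expert review.

Audit of (K-Φ2) XV `PhiLine.betaS_step_lt_of_keep_pow` (p706570): its binders `(hdp : d < p) (hnd : n ≤ d)` are used ONLY to obtain
`0 < p − n` for `p ∤ r_h`; the KEEP law itself — abstract law `WeightedOrder.betaS_colon_u2_lt` on the colon ideal, child-side cleaning
transfer (T1) `pts_nonempty_and_alphaS_betaS_eq_of_cleaning_pow_symm` with `ρ ∈ (u₁^n)` under the child threshold `d·(αs′ + 1) ≤ n·d!` —
holds for every cleaning exponent `0 < n < p`.  The companion facts for a subcritical letter (`n > d`): the LOSE law XV §4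
`betaS_step_le_of_lose_of_child_pow` already has no `n ≤ d`; the α-bound at the child is NOT given by (K-Φ1)-n (`n ≤ d` there is
essential: a single subcritical letter bounds nothing) but can be by (K-Φ1)-T `mul_alphaS_le_of_isIsolated_letters` (p711809) when the
boundary letters lying in `(y₁, y₂, u₁)` — e.g. CONE letters `W` with `V ⊆ E_W` (res-dim4-p-9 `coneLetter_or_entryFrame`) — have total weight
`r(T) ≥ p − d`.  This file proves the one missing piece:

* **`betaS_step_lt_of_keep_pow_of_lt`** — XV's KEEP law with `(hdp) (hnd)` ↦ `(hnp : n < p)`; XV's statement is its instance `n ≤ d < p`.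

[cite: CossartJannsenSaito2020, Lemma 12.2 (5), Lemma 13.4 (3)] [cite: CossartPiltant2008, (16)] [cite: Hauser2010, §§F–G]
bears_on: LADDER-RESOLUTION:D157-DOOR2 (res-dim4-pi · K2(p) rung 1 · Φ-line KEEP for any letter).  Supports
stmt-ResolutionOfSingularities-16155 (helper).
-/

set_option linter.dupNamespace false -- mandated namespace of this single-conjunct summit

noncomputable section

namespace Summit.ResolutionOfSingularities.ResolutionOfSingularities.Theorems.PIDim4

namespace PhiLine

open MvPolynomial Finset IsLocalRing
open Literature.AlgebraicGeometry.Resolution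
open Literature.AlgebraicGeometry.Resolution.Hauser2010
open Literature.AlgebraicGeometry.Resolution.WeightedOrder

variable {K : Type} [Field K]

/-- **KEEP-h ONE-STEP LAW FOR ANY BOUNDARY LETTER** ((K-Φ2) XV `betaS_step_lt_of_keep_pow` with its hypotheses `n ≤ d`, `d < p`
replaced by `n < p` alone — they were used only for `0 < p − n`).  Let `s.F = x^r · G` with `ord₀ G = d`, `p ≤ |r| + d`, a boundary
letter `h` with cleaning exponent `n` (`r_h + n = p`, `0 < n < p`, i.e. `0 < r_h < p`), chart letter `m ≠ h`, new point `b` with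
`b_m = b_h = 0`; `L` a left-invertible linear STEP frame (`u₁ = e_h`, `u₂ = e_m`, non-pivot rows through the new point) with non-empty
polygon, `δ > 1`, `α < 1` for `(G)`; `L′` the ARRIVAL frame.  If the next residual `G′` has `ord₀ G′ ≥ d` and, in the arrival frame, a
non-empty polygon with `d·(αs′ + 1) ≤ n·d!`, then `αs′ = αs` and **`βs′ < βs`**.  For a SUBCRITICAL letter (`n > d`) the child threshold is
NOT supplied by the single-letter (K-Φ1)-n (which needs `n ≤ d`) but may be by the letter-SET reading `mul_alphaS_le_of_isIsolated_letters`
(p711809: companions / cone letters lying in `(y₁, y₂, u₁)` count toward criticality: `d·αs′ ≤ (n_T − 1)·d!` with `n_T = p − r(T) ≤ d ≤ n`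
implies `d·(αs′ + 1) ≤ n·d!`).  The cleaning correction `R̃ ∈ (x_h^n)` is moved by (T1) from the child side as in XV.
[cite: CossartJannsenSaito2020, Lemma 13.4 (3)] [cite: CossartPiltant2008, (16)] -/
theorem betaS_step_lt_of_keep_pow_of_lt {p d n : ℕ} [DecidableEq K] {s : State K} {r : Fin 4 →₀ ℕ} {G : MvPolynomial (Fin 4) K}
    (hF : s.F = monomial r 1 * G) (hd : ordZero G = d) (hp : p ≤ r.degree + d)
    {h m : Fin 4} (hhm : h ≠ m) (hn : r h + n = p) (hn0 : 0 < n) (hnp : n < p) {b : Fin 4 → K} (hbm : b m = 0) (hbh : b h = 0)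
    (L L' : Fin (2 + 2) → Fin 4 → K) (M M' : Fin 4 → Fin (2 + 2) → K)
    (hM : ∀ t u, ∑ i, M t i * L i u = if t = u then 1 else 0) (hM' : ∀ t u, ∑ i, M' t i * L' i u = if t = u then 1 else 0)
    (hLu1 : L (u1 2) = Pi.single h 1) (hLu2 : L (u2 2) = Pi.single m 1)
    (hnear : ∀ i, i ≠ u2 2 → ∑ t, L i t * Function.update b m 1 t = 0)
    (hL'u2 : L' (u2 2) = Pi.single m 1) (hL' : ∀ i, i ≠ u2 2 → L' i = Function.update (L i) m 0)
    (hne : (pts (fun i => algebraMap (MvPolynomial (Fin 4) K) (OriginLocalization K 4) (∑ t, C (L i t) * X t))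
      (Ideal.span {algebraMap (MvPolynomial (Fin 4) K) (OriginLocalization K 4) G}) d).Nonempty)
    (hδ : d.factorial < deltaS (fun i => algebraMap (MvPolynomial (Fin 4) K) (OriginLocalization K 4) (∑ t, C (L i t) * X t))
      (Ideal.span {algebraMap (MvPolynomial (Fin 4) K) (OriginLocalization K 4) G}) d)
    (hα : alphaS (fun i => algebraMap (MvPolynomial (Fin 4) K) (OriginLocalization K 4) (∑ t, C (L i t) * X t))
      (Ideal.span {algebraMap (MvPolynomial (Fin 4) K) (OriginLocalization K 4) G}) d < d.factorial)
    {G' : MvPolynomial (Fin 4) K}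
    (hF' : (CentreBlowup.step p Finset.univ m b s).F = monomial ((r.filter fun i => b i = 0).update m (r.degree + d - p)) 1 * G')
    (hd' : (d : ℕ∞) ≤ ordZero G')
    (hne' : (pts (fun i => algebraMap (MvPolynomial (Fin 4) K) (OriginLocalization K 4) (∑ t, C (L' i t) * X t))
      (Ideal.span {algebraMap (MvPolynomial (Fin 4) K) (OriginLocalization K 4) G'}) d).Nonempty)
    (hα' : d * (alphaS (fun i => algebraMap (MvPolynomial (Fin 4) K) (OriginLocalization K 4) (∑ t, C (L' i t) * X t))
      (Ideal.span {algebraMap (MvPolynomial (Fin 4) K) (OriginLocalization K 4) G'}) d + 1) ≤ n * d.factorial) :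
    (pts (fun i => algebraMap (MvPolynomial (Fin 4) K) (OriginLocalization K 4) (∑ t, C (L' i t) * X t))
        (Ideal.span {algebraMap (MvPolynomial (Fin 4) K) (OriginLocalization K 4) G'}) d).Nonempty ∧
      alphaS (fun i => algebraMap (MvPolynomial (Fin 4) K) (OriginLocalization K 4) (∑ t, C (L' i t) * X t))
          (Ideal.span {algebraMap (MvPolynomial (Fin 4) K) (OriginLocalization K 4) G'}) d =
        alphaS (fun i => algebraMap (MvPolynomial (Fin 4) K) (OriginLocalization K 4) (∑ t, C (L i t) * X t))
          (Ideal.span {algebraMap (MvPolynomial (Fin 4) K) (OriginLocalization K 4) G}) d ∧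
      betaS (fun i => algebraMap (MvPolynomial (Fin 4) K) (OriginLocalization K 4) (∑ t, C (L' i t) * X t))
          (Ideal.span {algebraMap (MvPolynomial (Fin 4) K) (OriginLocalization K 4) G'}) d <
        betaS (fun i => algebraMap (MvPolynomial (Fin 4) K) (OriginLocalization K 4) (∑ t, C (L i t) * X t))
          (Ideal.span {algebraMap (MvPolynomial (Fin 4) K) (OriginLocalization K 4) G}) d := by
  -- abbreviations
  set alg := algebraMap (MvPolynomial (Fin 4) K) (OriginLocalization K 4) with halg
  set c : Fin (2 + 2) → OriginLocalization K 4 := fun i => alg (∑ t, C (L i t) * X t) with hc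
  set c' : Fin (2 + 2) → OriginLocalization K 4 := fun i => alg (∑ t, C (L' i t) * X t) with hc'
  set J : Ideal (OriginLocalization K 4) := Ideal.span {alg G} with hJ
  set φ := Localization.localRingHom (Literature.AlgebraicGeometry.Resolution.originIdeal K 4)
      (Literature.AlgebraicGeometry.Resolution.originIdeal K 4)
      (((aeval fun i => (X i + C (b i) : MvPolynomial (Fin 4) K)).comp
        (coordBlowupSubst K (↑(Finset.univ : Finset (Fin 4))) m)).toRingHom)
      (comap_translate_coordBlowupSubst_originIdeal hbm) with hφ
  have hdG : (d : ℕ∞) ≤ ordZero G := hd.symm.le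
  -- the frames
  have hcu2 : c (u2 2) = alg (X m) := by simp only [hc, hLu2, sum_C_single_mul_X]
  have hc'u2 : c' (u2 2) = alg (X m) := by simp only [hc', hL'u2, sum_C_single_mul_X]
  have hc'u1 : c' (u1 2) = alg (X h) := by
    simp only [hc', hL' (u1 2) u1_ne_u2, hLu1, update_single_of_ne hhm, sum_C_single_mul_X]
  have hpiv : c' (u2 2) = φ (c (u2 2)) := by rw [hc'u2, hcu2, hφ, localRingHom_chart_X_self hbm]
  have hoth : ∀ i, i ≠ u2 2 → φ (c i) = φ (c (u2 2)) * c' i := by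
    intro i hi
    rw [hcu2, hφ, localRingHom_chart_X_self hbm]
    change Localization.localRingHom _ _ _ _ (alg (∑ t, C (L i t) * X t)) = alg (X m) * alg (∑ t, C (L' i t) * X t)
    rw [hL' i hi, halg, localRingHom_chart_linearForm hbm (L i) (hnear i hi)]
  have hgen : Ideal.span (Set.range c) = maximalIdeal _ := span_range_linearFrame_eq_maximalIdeal L M hM
  have hgen' : Ideal.span (Set.range c') = maximalIdeal _ := span_range_linearFrame_eq_maximalIdeal L' M' hM'
  have hdim := ringKrullDim_originLocalization_two_add_two (K := K)
  have hJμ : J ≤ maximalIdeal _ ^ d := span_singleton_algebraMap_le_maximalIdeal_pow hdG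
  -- the abstract KEEP law (about the colon ideal, whatever its order)
  have hlaw := betaS_colon_u2_lt φ hpiv hoth hgen hdim hgen' hdim hJμ hne hδ hα
  have hαlaw := alphaS_colon_u2_eq φ hpiv hoth hgen hdim hgen' hdim hJμ hne hδ
  -- the weak transform is `(H₀)`
  have hcolon : (J.map φ).colon {φ (c (u2 2)) ^ d} =
      Ideal.span {alg (PointBlowup.translate b (CentreBlowup.chartTransform d Finset.univ m G))} := by
    rw [hcu2, hφ, localRingHom_chart_X_self hbm, hJ, halg]
    exact colon_map_span_singleton_chart hbm G hdG
  rw [hcolon] at hlaw hαlaw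
  -- the next residual `G′ = ε H₀ + R̃`, `R̃ ∈ (x_h^n)`
  obtain ⟨R, hstep, hRmem⟩ := step_F_eq_monomial_mul_residual (p := p) hF hdG hp m hbm
  rw [hF', monomial_one_mul_cancel_left_iff] at hstep
  have hr'h : ((r.filter fun i => b i = 0).update m (r.degree + d - p)) h = p - n := by
    rw [Finsupp.coe_update, Function.update_of_ne hhm, Finsupp.filter_apply_pos (fun i => b i = 0) r hbh]; omega
  have hndvd : ¬ p ∣ ((r.filter fun i => b i = 0).update m (r.degree + d - p)) h := by
    rw [hr'h]
    intro hdvd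
    exact absurd (Nat.le_of_dvd (by omega) hdvd) (by omega)
  have hR : R ∈ Ideal.span {(X h : MvPolynomial (Fin 4) K) ^ n} := by
    have := hRmem h hndvd
    rwa [hr'h, show p - (p - n) = n by omega] at this
  -- (T1) from the child side: `(G′) ⊆ 𝔪^d`, the child's polygon data, `alg R̃ ∈ (u₁′^n)`
  have hε := constantCoeff_prod_ne_zero b (fun i => r i)
  have hG' : Ideal.span {alg G'} = Ideal.span {alg (∏ i ∈ Finset.univ.filter (fun i => b i ≠ 0), (X i + C (b i)) ^ r i) *
      alg (PointBlowup.translate b (CentreBlowup.chartTransform d Finset.univ m G)) + alg R} := by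
    rw [hstep, map_add, map_mul]
  rw [hG'] at hne' hα' ⊢
  have hJμ' : Ideal.span {alg (∏ i ∈ Finset.univ.filter (fun i => b i ≠ 0), (X i + C (b i)) ^ r i) *
      alg (PointBlowup.translate b (CentreBlowup.chartTransform d Finset.univ m G)) + alg R} ≤ maximalIdeal _ ^ d := by
    rw [← hG']
    exact span_singleton_algebraMap_le_maximalIdeal_pow hd'
  have hclean := pts_nonempty_and_alphaS_betaS_eq_of_cleaning_pow_symm c' hgen' hdim
    (isUnit_algebraMap_of_constantCoeff_ne_zero hε) hJμ' hne' hα'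
    (by rw [hc'u1]; exact algebraMap_mem_span_pow_of_mem_span_pow le_rfl hR)
  exact ⟨hne', hclean.2.1.trans hαlaw, hclean.2.2.trans_lt hlaw⟩


/-- **From the letter-SET α-clause to the KEEP/LOSE threshold of the tracked letter.**  If `d·a ≤ (m − 1)·d!` (the conclusion of
(K-Φ1)-T `mul_alphaS_le_of_isIsolated_letters` with `m = p − r(T)`, `1 ≤ m`) and `m ≤ n` (the cleaning exponent `n = p − r_h` of the tracked
letter `h ∈ T` alone is at least `m`), then `d·(a + 1) ≤ n·d!` — the child-side input of `betaS_step_lt_of_keep_pow_of_lt` /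
`betaS_step_le_of_lose_of_child_pow`. [folklore] -/
theorem mul_succ_le_mul_factorial_of_le {d a m n : ℕ} (h : d * a ≤ (m - 1) * d.factorial) (hm : 1 ≤ m) (hmn : m ≤ n) :
    d * (a + 1) ≤ n * d.factorial := by
  have hdf : d ≤ d.factorial := Nat.self_le_factorial d
  have h2 : (m - 1) * d.factorial + d.factorial = m * d.factorial := by
    obtain ⟨k, rfl⟩ := Nat.exists_eq_add_of_le hm
    rw [Nat.add_sub_cancel_left, add_mul, one_mul, add_comm]
  calc d * (a + 1) = d * a + d := by ring
    _ ≤ (m - 1) * d.factorial + d.factorial := Nat.add_le_add h hdf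
    _ = m * d.factorial := h2
    _ ≤ n * d.factorial := Nat.mul_le_mul_right _ hmn

end PhiLine

end Summit.ResolutionOfSingularities.ResolutionOfSingularities.Theorems.PIDim4

end
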